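import Mathlib.Analysis.SpecificLimits.Basic
import Mathlib.Analysis.SpecialFunctions.Pow.Real
import HarnessLib

/-!
# Amplitude ledger of a level cascade: the level-Reynolds ratio `r = g / λ` and its floor

Cell `pub-fluidc` (FLUID COMPUTER; host summit `NavierStokesRegularity`, negation side, machine
paradigm), prover seat p1, R2 "AMPLITUDE RUNG" (`HOME/PLAN.md` §0/§3, `SCHEMA.md` 9.21).
HONEST FRAMING: low prior, high value-of-information experiment on Tao's machine paradigm;
NOT a claim that NS blows up. Nothing in this file is about the Navier–Stokes equations: these
are elementary facts about real sequences — the DICTIONARY the atlas's Table A13 cites.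

Setting. A cascade organised through levels `n = 0, 1, 2, …` with wavenumbers
`k_n = k₀ λⁿ` (`λ > 1`), viscosity `ν > 0`, and level sup-amplitudes `U_n ≥ 0` (in the atlas:
band sup-velocities `max_x |P_B u|`; in the Cheskidov–Shvydkoy dictionary: `λ = 2`,
`U_j = sup_t ‖Δ̇_j u(t)‖_∞`). The **level Reynolds number** is `Re_n = U_n / (ν k_n)`, the
**amplitude gain** of a step is `g_n = U_{n+1} / U_n`, and the **level-Reynolds ratio** is
`r_n = g_n / λ = Re_{n+1} / Re_n` (`SPEC-SHEET` keys `amp_gain`, `re_gain`).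

* `levelRe_succ`, `levelRe_eq_mul_prod` — the ledger identity `Re_{n+1} = r_n · Re_n`, hence
  `Re_n = Re_0 · ∏_{i<n} r_i`.
* `levelRe_succ_le_of_gain_le` — a step with `U_{n+1} ≤ q λ U_n` has `Re_{n+1} ≤ q Re_n`.
* `tendsto_levelRe_zero_of_eventually_gain_le` — THE NULL SIDE: if eventually every step has
  gain `≤ q λ` with `q < 1` (e.g. the classical-cascade null `g = λ^{-1/3}`, `r = λ^{-4/3}`), then
  `Re_n → 0`.
* `frequently_gain_gt_of_frequently_levelRe_ge` — THE FLOOR (contrapositive): if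
  `Re_n ≥ c > 0` for infinitely many `n`, then for every `q < 1` infinitely many steps have gain
  `> q λ`, i.e. `r > q`: "`r ≥ 1` up to every margin, infinitely often".
* `not_eventually_gain_le_rpow` — the same in the `λ^{1-ε}` spelling of `HOME/PLAN.md` §3:
  `Re_n ≥ c` frequently ⟹ ¬ (eventually `U_{n+1} ≤ λ^{1-ε} U_n`).
* `frequently_pow_lt_prod_reGain` — geometric-mean spelling: `Re_n ≥ c` frequently ⟹
  `qⁿ < ∏_{i<n} r_i` frequently for every `q < 1` (the "`ḡ ≥ λ`, `r̄ ≥ 1`" reading of PLAN §0).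
* `reGain_null_lt_one` — the K41 null ratio `λ^{-4/3} < 1` for `λ > 1` (so the null side
  applies to it).

Why the floor is the machine's necessity (pointer, not proved here): Cheskidov–Shvydkoy 2010,
Lemma 3.2 — a Leray–Hopf solution with `limsup_j sup_t 2^{-j} ‖Δ̇_j u(t)‖_∞ < c ν` is regular —
is DISCHARGED in the tree as `Literature.Analysis.FluidPDE.cheskidov_shvydkoy_dyadic_holds`; in
the notation above (`λ = 2`, `k₀ = 1`) its hypothesis is "`levelRe` eventually `< c`", so a
singular solution has `levelRe ≥ c` frequently and this file's floor applies. The PDE-side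
statement (`LevelReynoldsFloor`) is seat p2's; this file is the sequence arithmetic only.
[cite: CheskidovShvydkoy2010, Lemma 3.2] (pointer only; nothing of the paper is restated here).
-/

noncomputable section

namespace Summit.NavierStokesRegularity.FluidComputer.AmplitudeLedger

open Real Filter Topology Finset

/-- Level wavenumbers `k_n = k₀ λⁿ`. -/
def levelK (k0 lam : ℝ) (n : ℕ) : ℝ := k0 * lam ^ n

/-- Level Reynolds number `Re_n = U_n / (ν k_n)`. -/
def levelRe (ν k0 lam : ℝ) (U : ℕ → ℝ) (n : ℕ) : ℝ := U n / (ν * levelK k0 lam n)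

/-- Amplitude gain of the step `n → n+1`: `g_n = U_{n+1} / U_n` (`amp_gain`). -/
def ampGain (U : ℕ → ℝ) (n : ℕ) : ℝ := U (n + 1) / U n

/-- Level-Reynolds ratio of the step `n → n+1`: `r_n = g_n / λ` (`re_gain`). -/
def reGain (lam : ℝ) (U : ℕ → ℝ) (n : ℕ) : ℝ := ampGain U n / lam

variable {ν k0 lam : ℝ} {U : ℕ → ℝ}

/-- `k_{n+1} = λ k_n`. -/
theorem levelK_succ (k0 lam : ℝ) (n : ℕ) : levelK k0 lam (n + 1) = lam * levelK k0 lam n := by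
  simp only [levelK, pow_succ]; ring

/-- `k_n > 0` for `k₀ > 0`, `λ > 0`. -/
theorem levelK_pos (hk0 : 0 < k0) (hlam : 0 < lam) (n : ℕ) : 0 < levelK k0 lam n :=
  mul_pos hk0 (pow_pos hlam n)

/-- `Re_n ≥ 0` when `U_n ≥ 0`, `ν > 0`, `k₀ > 0`, `λ > 0`. -/
theorem levelRe_nonneg (hν : 0 < ν) (hk0 : 0 < k0) (hlam : 0 < lam) {n : ℕ} (hU : 0 ≤ U n) :
    0 ≤ levelRe ν k0 lam U n :=
  div_nonneg hU (mul_pos hν (levelK_pos hk0 hlam n)).le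

/-- THE LEDGER IDENTITY: `Re_{n+1} = r_n · Re_n` (for `U_n ≠ 0`, `λ ≠ 0`). -/
theorem levelRe_succ (hν : ν ≠ 0) (hk0 : k0 ≠ 0) (hlam : lam ≠ 0) {n : ℕ} (hU : U n ≠ 0) :
    levelRe ν k0 lam U (n + 1) = reGain lam U n * levelRe ν k0 lam U n := by
  have hk : levelK k0 lam n ≠ 0 := mul_ne_zero hk0 (pow_ne_zero n hlam)
  simp only [levelRe, reGain, ampGain, levelK_succ]
  field_simp

/-- `Re_n = Re_0 · ∏_{i<n} r_i` (all `U_i ≠ 0`). -/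
theorem levelRe_eq_mul_prod (hν : ν ≠ 0) (hk0 : k0 ≠ 0) (hlam : lam ≠ 0) (hU : ∀ i, U i ≠ 0)
    (n : ℕ) :
    levelRe ν k0 lam U n = levelRe ν k0 lam U 0 * ∏ i ∈ range n, reGain lam U i := by
  induction n with
  | zero => simp
  | succ n ih =>
    rw [levelRe_succ hν hk0 hlam (hU n), ih, Finset.prod_range_succ]; ring

/-- A step with amplitude gain at most `q λ` lowers the level Reynolds number by the factor `q`:
`U_{n+1} ≤ q λ U_n ⟹ Re_{n+1} ≤ q Re_n`. -/
theorem levelRe_succ_le_of_gain_le (hν : 0 < ν) (hk0 : 0 < k0) (hlam : 0 < lam) {q : ℝ} {n : ℕ}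
    (h : U (n + 1) ≤ q * lam * U n) :
    levelRe ν k0 lam U (n + 1) ≤ q * levelRe ν k0 lam U n := by
  have hk : 0 < levelK k0 lam n := levelK_pos hk0 hlam n
  simp only [levelRe, levelK_succ]
  rw [div_le_iff₀ (mul_pos hν (mul_pos hlam hk))]
  have hid : q * (U n / (ν * levelK k0 lam n)) * (ν * (lam * levelK k0 lam n)) = q * lam * U n := by
    field_simp
  rw [hid]
  exact h

/-- THE NULL SIDE. If from some level on every step has amplitude gain `≤ q λ` with
`0 ≤ q < 1` (nonnegative amplitudes), the level Reynolds numbers tend to `0`. -/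
theorem tendsto_levelRe_zero_of_eventually_gain_le (hν : 0 < ν) (hk0 : 0 < k0) (hlam : 0 < lam)
    (hU : ∀ n, 0 ≤ U n) {q : ℝ} (hq0 : 0 ≤ q) (hq1 : q < 1)
    (h : ∀ᶠ n in atTop, U (n + 1) ≤ q * lam * U n) :
    Tendsto (levelRe ν k0 lam U) atTop (𝓝 0) := by
  obtain ⟨N, hN⟩ := eventually_atTop.1 h
  have hRe0 : ∀ n, 0 ≤ levelRe ν k0 lam U n := fun n =>
    div_nonneg (hU n) (mul_pos hν (levelK_pos hk0 hlam n)).le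
  -- geometric domination from level N on
  have hdom : ∀ m, levelRe ν k0 lam U (N + m) ≤ q ^ m * levelRe ν k0 lam U N := by
    intro m
    induction m with
    | zero => simp
    | succ m ih =>
      have hstep := levelRe_succ_le_of_gain_le (U := U) hν hk0 hlam (hN (N + m) (by omega))
      calc levelRe ν k0 lam U (N + (m + 1)) = levelRe ν k0 lam U (N + m + 1) := by rw [add_assoc]
        _ ≤ q * levelRe ν k0 lam U (N + m) := hstep
        _ ≤ q * (q ^ m * levelRe ν k0 lam U N) := mul_le_mul_of_nonneg_left ih hq0
        _ = q ^ (m + 1) * levelRe ν k0 lam U N := by ring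
  have hgeo : Tendsto (fun m => q ^ m * levelRe ν k0 lam U N) atTop (𝓝 0) := by
    simpa using (tendsto_pow_atTop_nhds_zero_of_lt_one hq0 hq1).mul_const (levelRe ν k0 lam U N)
  have hshift : Tendsto (fun m => levelRe ν k0 lam U (N + m)) atTop (𝓝 0) :=
    tendsto_of_tendsto_of_tendsto_of_le_of_le tendsto_const_nhds hgeo (fun m => hRe0 _) hdom
  -- undo the shift
  rw [← tendsto_add_atTop_iff_nat N]
  simpa [add_comm] using hshift

/-- THE FLOOR (contrapositive of the null side). If `Re_n ≥ c > 0` at infinitely many levels,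
then for every `q < 1` infinitely many steps have amplitude gain `> q λ` (level-Reynolds ratio
`r > q`). -/
theorem frequently_gain_gt_of_frequently_levelRe_ge (hν : 0 < ν) (hk0 : 0 < k0) (hlam : 0 < lam)
    (hU : ∀ n, 0 ≤ U n) {c : ℝ} (hc : 0 < c) (hfreq : ∃ᶠ n in atTop, c ≤ levelRe ν k0 lam U n)
    {q : ℝ} (hq1 : q < 1) :
    ∃ᶠ n in atTop, q * lam * U n < U (n + 1) := by
  by_contra hnot
  have hev : ∀ᶠ n in atTop, U (n + 1) ≤ max q 0 * lam * U n := by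
    filter_upwards [not_frequently.1 hnot] with n hn
    calc U (n + 1) ≤ q * lam * U n := not_lt.1 hn
      _ ≤ max q 0 * lam * U n :=
          mul_le_mul_of_nonneg_right (mul_le_mul_of_nonneg_right (le_max_left q 0) hlam.le) (hU n)
  have ht := tendsto_levelRe_zero_of_eventually_gain_le hν hk0 hlam hU (le_max_right _ _)
    (max_lt hq1 one_pos) hev
  have hsmall : ∀ᶠ n in atTop, levelRe ν k0 lam U n < c := (tendsto_order.1 ht).2 c hc
  obtain ⟨n, hn1, hn2⟩ := (hfreq.and_eventually hsmall).exists
  exact absurd hn2 (not_lt.2 hn1)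

/-- The floor in the `λ^{1-ε}` spelling (`HOME/PLAN.md` §3 p1): `Re_n ≥ c > 0` frequently ⟹ it
is NOT the case that eventually `U_{n+1} ≤ λ^{1-ε} U_n` (`λ > 1`, `ε > 0`). -/
theorem not_eventually_gain_le_rpow (hν : 0 < ν) (hk0 : 0 < k0) (hlam : 1 < lam)
    (hU : ∀ n, 0 ≤ U n) {c : ℝ} (hc : 0 < c) (hfreq : ∃ᶠ n in atTop, c ≤ levelRe ν k0 lam U n)
    {ε : ℝ} (hε : 0 < ε) :
    ¬ ∀ᶠ n in atTop, U (n + 1) ≤ lam ^ (1 - ε) * U n := by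
  have hlam0 : 0 < lam := one_pos.trans hlam
  -- λ^{1-ε} = q λ with q = λ^{-ε} < 1
  have hq1 : lam ^ (-ε) < 1 := Real.rpow_lt_one_of_one_lt_of_neg hlam (by linarith)
  have hsplit : lam ^ (1 - ε) = lam ^ (-ε) * lam := by
    rw [show (1 - ε) = -ε + 1 by ring, Real.rpow_add hlam0, Real.rpow_one]
  intro hev
  have hfr := frequently_gain_gt_of_frequently_levelRe_ge hν hk0 hlam0 hU hc hfreq hq1
  obtain ⟨n, hlt, hle⟩ := (hfr.and_eventually hev).exists
  rw [hsplit] at hle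
  exact (not_lt.2 hle) hlt

/-- THE FLOOR, geometric-mean spelling: if `Re_n ≥ c > 0` at infinitely many levels (positive
amplitudes), then for every `0 ≤ q < 1` the running product of the level-Reynolds ratios beats
`qⁿ` infinitely often, `qⁿ < ∏_{i<n} r_i` — i.e. the geometric-mean ratio `r̄ = (∏_{i<n} r_i)^{1/n}`
has `limsup r̄ ≥ 1` ("`ḡ ≥ λ`"). -/
theorem frequently_pow_lt_prod_reGain (hν : 0 < ν) (hk0 : 0 < k0) (hlam : 0 < lam)
    (hU : ∀ n, 0 < U n) {c : ℝ} (hc : 0 < c) (hfreq : ∃ᶠ n in atTop, c ≤ levelRe ν k0 lam U n)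
    {q : ℝ} (hq0 : 0 ≤ q) (hq1 : q < 1) :
    ∃ᶠ n in atTop, q ^ n < ∏ i ∈ range n, reGain lam U i := by
  have hRe0 : 0 < levelRe ν k0 lam U 0 := div_pos (hU 0) (mul_pos hν (levelK_pos hk0 hlam 0))
  have hgeo : Tendsto (fun n => q ^ n * levelRe ν k0 lam U 0) atTop (𝓝 0) := by
    simpa using (tendsto_pow_atTop_nhds_zero_of_lt_one hq0 hq1).mul_const (levelRe ν k0 lam U 0)
  have hsmall : ∀ᶠ n in atTop, q ^ n * levelRe ν k0 lam U 0 < c := (tendsto_order.1 hgeo).2 c hc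
  refine (hfreq.and_eventually hsmall).mono ?_
  rintro n ⟨hcn, hqn⟩
  have hprod := levelRe_eq_mul_prod hν.ne' hk0.ne' hlam.ne' (fun i => (hU i).ne') n
  have hlt : q ^ n * levelRe ν k0 lam U 0 < levelRe ν k0 lam U 0 * ∏ i ∈ range n, reGain lam U i := by
    rw [← hprod]; exact hqn.trans_le hcn
  rw [mul_comm] at hlt
  exact lt_of_mul_lt_mul_left hlt hRe0.le

/-- The classical-cascade (K41) null ratio `r_null = λ^{-4/3}` is `< 1` for `λ > 1`, so the null
side applies to a cascade whose steps all sit at the null. -/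
theorem reGain_null_lt_one (hlam : 1 < lam) : lam ^ (-(4 / 3 : ℝ)) < 1 :=
  Real.rpow_lt_one_of_one_lt_of_neg hlam (by norm_num)

/-! ### The geometry dictionary: `Dc_sup`, `codim_star`, and `g ≥ λ ⟺ Dc_sup ≥ codim_star`

`HOME/PLAN.md` §0 / `SPEC-SHEET` §2(D): the one-step sup-norm concentration dimension
`Dc_sup = 2 log(g/√η)/log λ` and the critical codimension `codim_star = 2 + log(1/η)/log λ`;
the machine floor `r ≥ 1` (`g ≥ λ`) is the same inequality as `Dc_sup ≥ codim_star`
("beats viscosity"). Pure real arithmetic (appended 2026-08-22 by seat p1). -/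

/-- The sup-norm concentration dimension read from one step, `Dc_sup = 2 log(g/√η) / log λ`
(`SPEC-SHEET` §2(D) `Dc_sup`, `SCHEMA` 9.21(c)). -/
def dcSup (lam eta g : ℝ) : ℝ := 2 * Real.log (g / Real.sqrt eta) / Real.log lam

/-- The critical codimension `codim_star = 2 + log(1/η) / log λ` (`SPEC-SHEET` §2(D)). -/
def codimStar (lam eta : ℝ) : ℝ := 2 + Real.log (1 / eta) / Real.log lam

/-- `codim_star` over the common denominator: `(2 log λ − log η)/log λ` (`λ > 1`). -/
theorem codimStar_eq (hlam : 1 < lam) (eta : ℝ) :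
    codimStar lam eta = (2 * Real.log lam - Real.log eta) / Real.log lam := by
  have hL : Real.log lam ≠ 0 := (Real.log_pos hlam).ne'
  unfold codimStar
  rw [one_div, Real.log_inv]
  field_simp
  ring

/-- `Dc_sup` over the common denominator: `(2 log g − log η)/log λ` (`η > 0`, `g > 0`). -/
theorem dcSup_eq {eta g : ℝ} (heta : 0 < eta) (hg : 0 < g) (lam : ℝ) :
    dcSup lam eta g = (2 * Real.log g - Real.log eta) / Real.log lam := by
  unfold dcSup
  rw [Real.log_div hg.ne' (Real.sqrt_pos.2 heta).ne', Real.log_sqrt heta.le]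
  ring

/-- THE DICTIONARY LINE of `HOME/PLAN.md` §0: for `λ > 1`, `η > 0`, `g > 0`,
`g ≥ λ ⟺ Dc_sup(λ, η, g) ≥ codim_star(λ, η)`. -/
theorem lam_le_iff_codimStar_le_dcSup (hlam : 1 < lam) {eta g : ℝ} (heta : 0 < eta)
    (hg : 0 < g) : lam ≤ g ↔ codimStar lam eta ≤ dcSup lam eta g := by
  have hlam0 : 0 < lam := one_pos.trans hlam
  have hL : 0 < Real.log lam := Real.log_pos hlam
  rw [codimStar_eq hlam, dcSup_eq heta hg, div_le_div_iff_of_pos_right hL,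
    ← Real.log_le_log_iff hlam0 hg]
  constructor <;> intro h <;> linarith

/-- In ledger terms: a step with positive amplitudes has level-Reynolds ratio `r_n ≥ 1` iff its
`Dc_sup ≥ codim_star` (any `η > 0`; `λ > 1`). -/
theorem one_le_reGain_iff_codimStar_le_dcSup (hlam : 1 < lam) {n : ℕ} (hUn : 0 < U n)
    (hUn1 : 0 < U (n + 1)) {eta : ℝ} (heta : 0 < eta) :
    1 ≤ reGain lam U n ↔ codimStar lam eta ≤ dcSup lam eta (ampGain U n) := by
  have hlam0 : 0 < lam := one_pos.trans hlam
  have hg : 0 < ampGain U n := div_pos hUn1 hUn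
  rw [← lam_le_iff_codimStar_le_dcSup hlam heta hg]
  unfold reGain
  rw [le_div_iff₀ hlam0, one_mul]

end Summit.NavierStokesRegularity.FluidComputer.AmplitudeLedger

end
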